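import Summits.QuantumFields.YangMills.Theorems.UnitScaleTiltProp8HalvingQuarterMatrix
import Summits.QuantumFields.YangMills.Theorems.UnitScaleTiltProp8FlatPullbackLinearity
import Summits.QuantumFields.YangMills.Theorems.UnitScaleTiltProp8FlatOpsLettersAssembly
import HarnessLib

/-!
# Route `UnitScaleTilt`, crux K1 child «MinimiserStabilityRegPr» (stmt-QuantumFields-19200), registered stub V2′ `stub_halvingStep`
# (skeletons v8 5b4e846794b80374 / v10 pen `BirthV10`, OWNER RULING g24-№5) — **THE PER-SITE CLAUSE OF THE (167)-CHART SCHEMA `H` OF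
# `Prop8LastMile` FROM THE PIECES OF [Balaban1985Variational] (159)**: at a site `x`, a chart `(u b₋)⁻¹U(b)u(b₊) = e^{iηA(b)}` on the bonds around `x`
# with `A = A₁ + HB − R` — `HB` the P2 operator of the cube sequence centred at `x` on a `𝔤`-valued datum `B` of near size `C₁ε₁(d + 1)` ((160)) and
# far size `C₂ε₀L^{k−j}` ((155)), `A₁` ((158), F4/P3b/P5) and `R = HD(A′)` ((157), P3a) with their three letters `≤ e₁`, `≤ e₃` — GIVES the
# `∃ Ω ∋ x, u, A` clause of `H` at every `α₂ > e₁ + ¼max{4CB₀B₃ε₁, ½ε₀} + e₃` (`C = max{2C₁, C₂}`); the layer around `x` is ONE block thick, so the far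
# geometry needs only `ρ ≥ R₁M₁ + 2`

Cell `ym3-torus` (HUMAN RULING D-0037, YM ladder rung R3 — continuum SU(2) YM₃ on the torus is a RUNG, not the Clay problem), width seat
`ym-ust-19200-w3` gen 2 (D-0149; RULING g24-№5: «w5∕w3 g2 = halving»).  `--supports stmt-QuantumFields-19200 --as helper`; def-free, 0 sorry,
standard axioms.  Knits `HalvingQuarterMatrix.matrixRows164_quarter_top` (p593496) with w3 g0's `Prop8PullbackLin.torusBounds_of_decomp` (p585242)
and `Prop8PullbackDict.localChart_top_of_torus` (p584707).

THE PRINT ([Balaban1985Variational] p. 303–304): *«We have constructed the configuration U_k^u = e^{iηA}, and A is given by A = A₁ + HB − HD(A₁ + HB), (159)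
where A₁ satisfies Eq. (158). … This bound, the equality (159) and Eq. (158) imply |A|, |∇^ηA|, |∂^{η*}∂^ηA|, |Δ^ηA| < ¼M_Δmax{B₃ε₁, ½ε₀} +
B₀C₄(36dL²B₁Mε₀)² + B₀4C₂(36dL²B₁Mε₀)² (165) … Now let us draw conclusions concerning the regularity of U′_k from the above inequality. We take
Δ = Δ₀, hence M_Δ = 1»*.

WHAT THIS FILE PROVES (no definition, no sorry; `k = K − n`, `η = L^{−k}`, `S♯ = pullDom (topFam {x}) k` the pulled-back layer of the ONE-POINT top
family at `x`):
* §1 THE LAYER IS ONE BLOCK THICK: `distSite_transl_le_one` (`ℤᵈ`-neighbours have torus translates at sup distance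
  `≤ 1`), `distSite_iterBlockOf_le_one_of_le_one` (hence `k`-blocks at distance `≤ 1`), **`block_dist_le_one_of_sideTouches`** /
  **`block_dist_le_one_of_bondTouches`** — every bond of the `SideTouches`/`BondTouches` layer of `S♯` has its source's `k`-block within `1` of `Bᵏ(x)`.
* §2 **`siteClause_of_pieces`** — THE PER-SITE CLAUSE OF `H`: for `D := cubeSeqMT3 F n K x ρ S M`, the P2 letters `HDecayLetterD`/`RowSum162` of the
  canonical `flatH` over `dBI ≥ distBI`, (163) `4CB₀B₃e^{−½δ₀R₁M₁} ≤ ½` with `0 ≤ R₁M₁ ≤ ρ − 2`, a `𝔤`-valued datum `B` with NEAR size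
  `‖B(c)‖ ≤ C₁ε₁(dist_k(c₋, Bᵏx) + 1)` on the top level and FAR size `‖B(c)‖ ≤ C₂ε₀L^{k−j(c)}` below (`2C₁, C₂ ≤ C`), the kernel field
  `𝔄(b) = Σ_c (flatH e_c)(b)·B(c)`, a bondwise self-adjoint `A = A₁ + 𝔄 − R` charting `U` through `u` on the `SideTouches` layer of `S♯`
  (`(u b₋)⁻¹U(b)u(b₊) = expUnit(iηA(b))`), and the three letters of `A₁`, `R` on the layers bounded by `e₁`, `e₃`: for every
  `α₂ > e₁ + ¼max{4CB₀B₃ε₁, ½ε₀} + e₃` the clause `∃ Ω ∋ x, u, A, [chart ∀ j ≤ k] ∧ [Cond140 … α₂ ∀ j ≤ k]` of `Prop8LastMile`'s `H` holds at `x`.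
HONEST SCOPE: the pieces (chart, decomposition, letters of `A₁`/`R`, sizes of `B`, the P2 letters) are hypotheses — the sockets of pillars P1 ([B8] Thm 2 on
the cube sequence, (152)–(156)), P3a ((157)), F4/P3b/P5 ((158), (165)), P0/(160) (`HalvingDatum160`) and P2 (`FlatOpsAdmAtMS`, ✓ for odd `L ≥ 5` on big
tori).  Bookkeeping only; NOT a claim about the crux, the rung, or the mass gap.

References: T. Bałaban, CMP **102** (1985) 277–309 [Balaban1985Variational] (155)–(159) pp.302–303, (160)–(165) pp.303–304, (167)–(168) p.304;
CMP **99** (1985) 75–102 [Balaban1985RegularSpaces] (1.140)–(1.144) p.100, p.77.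
-/

set_option autoImplicit false

noncomputable section

open scoped BigOperators Matrix.Norms.L2Operator

namespace Summit.QuantumFields.YangMills.Theorems.HalvingSiteAssembly

open Literature.MathematicalPhysics.QuantumFieldTheory.Balaban1983to89
open Complex (I)
open B5Eq117TorusCarriers (Mk)
open B5Eq118OneStroke (iterBlockOf)
open B5Prop12FieldsLattice (distSite distSite_nonneg)
open B5RowSumsP12Lattice (distSite_comm distSite_triangle)
open B6SectADomainsV1 (Domains)
open B6SectAOperatorsV1 (BondIdx)
open B7Prop1Explicit (e e_apply expUnit)
open B7Eq92Concrete (mgauge)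
open B8Ineq132 (BondTouches PlaqTouches)
open B8Eq140Level (SideTouches Cond140 IsSide)
open B8Eq143PlaqExpansion (pdiv)
open B8Eq146AExpansion (plaqCovDeriv)
open B8Eq184Proof (cfgExp)
open B8Thm2SetupTorus (cfgPull gaugePull pullDom mem_pullSet)
open B10Eq27TorusAxialLog (pull unitsField toUField transl transl_apply transl_zero)
open T3ContinuumYM3Torus (T3Family)
open FlatCubeOpsText (distBI IsLevWeight HDecayLetterD RowSum162)
open FlatCubeSequenceAligned (cubeSeqMT3)
open FlatOpsLettersAssembly (flatH)
open FlatPortChart (pow_mul_distSite_iterBlockOf_le)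
open HalvingQuarterMatrix (matrixRows164_quarter_top)
open Prop8PullbackLin (torusBounds_of_decomp)
open Prop8PullbackDict (localChart_top_of_torus)

/-! ## §1 The layer of the one-point top family is one block thick -/

section Layer

variable {P : Params}

/-- **`ℤᵈ`-NEIGHBOURS HAVE NEIGHBOURING TRANSLATES**: if `|y_i − y′_i| ≤ 1` for every coordinate then `dist₀(0 + y, 0 + y′) ≤ 1` on the torus. [folklore] -/
theorem distSite_transl_le_one {y y' : B7Prop1Explicit.Site P.d} (h : ∀ i, (y i - y' i).natAbs ≤ 1) :
    distSite (Mk P 0) (transl (0 : Site P 0) y) (transl 0 y') ≤ 1 := by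
  unfold distSite
  have key : (Finset.univ.sup fun μ : Fin P.d => (((transl (0 : Site P 0) y) μ - (transl (0 : Site P 0) y') μ).valMinAbs).natAbs) ≤ 1 := by
    refine Finset.sup_le fun μ _ => ?_
    have hsub : (transl (0 : Site P 0) y) μ - (transl (0 : Site P 0) y') μ = ((y μ - y' μ : ℤ) : ZMod (P.sitesPerDir 0)) := by
      rw [transl_apply, transl_apply]; push_cast; ring
    rw [hsub]
    -- the least-absolute-value representative of an integer is not larger than the integer (`StrongCouplingShape.natAbs_valMinAbs_intCast_le`, inlined)
    exact (ZMod.natAbs_min_of_le_div_two _ _ _ (ZMod.coe_valMinAbs _) (ZMod.natAbs_valMinAbs_le _)).trans (h μ)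
  exact_mod_cast key

/-- Fine sites at sup distance `≤ 1` have `j`-blocks at sup distance `≤ 1` (`j ≤ m + K`). [folklore] -/
theorem distSite_iterBlockOf_le_one_of_le_one {j : ℕ} (hj : j ≤ P.m + P.K) {a b : Site P 0} (h : distSite (Mk P 0) a b ≤ 1) :
    distSite (Mk P j) (iterBlockOf j a) (iterBlockOf j b) ≤ 1 := by
  have h1 := pow_mul_distSite_iterBlockOf_le j hj a b
  have hLj : (0 : ℝ) < (P.L : ℝ) ^ j := by have := P.L_pos; positivity
  by_contra hgt
  rw [not_le] at hgt
  have : (P.L : ℝ) ^ j * 1 < (P.L : ℝ) ^ j * distSite (Mk P j) (iterBlockOf j a) (iterBlockOf j b) := mul_lt_mul_of_pos_left hgt hLj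
  linarith

/-- coordinates of `e_κ` are `0` or `1`. [folklore] -/
theorem e_apply_mem01 (κ i : Fin P.d) : (e κ : B7Prop1Explicit.Site P.d) i = 0 ∨ (e κ : B7Prop1Explicit.Site P.d) i = 1 := by
  rw [e_apply]; split_ifs <;> simp

/-- coordinates of `e_κ + e_ν`, `κ ≠ ν`, are `0` or `1`. [folklore] -/
theorem e_add_e_apply_mem01 {κ ν : Fin P.d} (hκν : κ ≠ ν) (i : Fin P.d) :
    (e κ + e ν : B7Prop1Explicit.Site P.d) i = 0 ∨ (e κ + e ν : B7Prop1Explicit.Site P.d) i = 1 := by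
  rw [Pi.add_apply, e_apply, e_apply]
  by_cases h1 : i = κ
  · subst h1; simp [hκν]
  · by_cases h2 : i = ν
    · subst h2; simp [h1]
    · simp [h1, h2]

variable (x : Site P 0) (k : ℕ)

/-- Membership in the pulled-back layer set of the one-point top family: `z ∈ S♯ ↔ 0 + z = x`. [cite: Balaban1985RegularSpaces, (1.3) p.77] -/
theorem mem_pullDom_top_singleton (z : B7Prop1Explicit.Site P.d) :
    z ∈ pullDom (fun j => if k ≤ j then ({x} : Set (Site P 0)) else (∅ : Set (Site P 0))) k ↔ transl (0 : Site P 0) z = x := by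
  show z ∈ B8Thm2SetupTorus.pullSet _ 0 ↔ _
  rw [mem_pullSet]
  simp

/-- **THE `SideTouches` LAYER IS ONE STEP THICK**: a side `⟨y, y + e_τ⟩` of a plaquette with a corner in `S♯ = {z : 0 + z = x}` has `dist₀(0 + y, x) ≤ 1`.
[cite: Balaban1985RegularSpaces, p.77 (convention before (1.5)), (1.2) p.76] -/
theorem dist_le_one_of_sideTouches {y : B7Prop1Explicit.Site P.d} {τ : Fin P.d}
    (h : SideTouches (pullDom (fun j => if k ≤ j then ({x} : Set (Site P 0)) else (∅ : Set (Site P 0))) k) y τ) :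
    distSite (Mk P 0) (transl (0 : Site P 0) y) x ≤ 1 := by
  obtain ⟨z, κ, ν, hκν, hP, hS⟩ := h
  -- a corner `c = z + c′` of the plaquette with `0 + c = x`, `c′ ∈ {0, e_κ, e_ν, e_κ + e_ν}`
  obtain ⟨c', hc, hc01⟩ : ∃ c' : B7Prop1Explicit.Site P.d, transl (0 : Site P 0) (z + c') = x ∧ ∀ i, c' i = 0 ∨ c' i = 1 := by
    rcases hP with h0 | h1 | h2 | h3
    · exact ⟨0, by rw [add_zero]; exact (mem_pullDom_top_singleton x k z).1 h0, fun i => Or.inl rfl⟩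
    · exact ⟨e κ, (mem_pullDom_top_singleton x k _).1 h1, e_apply_mem01 κ⟩
    · exact ⟨e ν, (mem_pullDom_top_singleton x k _).1 h2, e_apply_mem01 ν⟩
    · exact ⟨e κ + e ν, by rw [← add_assoc]; exact (mem_pullDom_top_singleton x k _).1 h3, e_add_e_apply_mem01 hκν⟩
  -- the side's source `y = z + a′`, `a′ ∈ {0, e_κ, e_ν}`
  obtain ⟨a', ha, ha01⟩ : ∃ a' : B7Prop1Explicit.Site P.d, y = z + a' ∧ ∀ i, a' i = 0 ∨ a' i = 1 := by
    rcases hS with ⟨hy, -⟩ | ⟨hy, -⟩ | ⟨hy, -⟩ | ⟨hy, -⟩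
    · exact ⟨0, by rw [add_zero]; exact hy, fun i => Or.inl rfl⟩
    · exact ⟨e κ, hy, e_apply_mem01 κ⟩
    · exact ⟨e ν, hy, e_apply_mem01 ν⟩
    · exact ⟨0, by rw [add_zero]; exact hy, fun i => Or.inl rfl⟩
  rw [← hc, ha]
  refine distSite_transl_le_one fun i => ?_
  have hdiff : (z + a') i - (z + c') i = a' i - c' i := by rw [Pi.add_apply, Pi.add_apply]; ring
  rw [hdiff]
  rcases ha01 i with h | h <;> rcases hc01 i with h' | h' <;> norm_num [h, h']

/-- **THE `BondTouches` LAYER IS ONE STEP THICK**: a bond `⟨y, y + e_μ⟩` with an end-point in `S♯ = {z : 0 + z = x}` has `dist₀(0 + y, x) ≤ 1`.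
[cite: Balaban1985RegularSpaces, p.77 (convention before (1.5))] -/
theorem dist_le_one_of_bondTouches {y : B7Prop1Explicit.Site P.d} {μ : Fin P.d}
    (h : BondTouches (pullDom (fun j => if k ≤ j then ({x} : Set (Site P 0)) else (∅ : Set (Site P 0))) k) y μ) :
    distSite (Mk P 0) (transl (0 : Site P 0) y) x ≤ 1 := by
  rcases h with h0 | h1
  · rw [(mem_pullDom_top_singleton x k y).1 h0, B5Prop12FieldsLattice.distSite_self]; norm_num
  · rw [← (mem_pullDom_top_singleton x k _).1 h1]
    refine distSite_transl_le_one fun i => ?_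
    have hdiff : y i - (y + e μ) i = -((e μ : B7Prop1Explicit.Site P.d) i) := by rw [Pi.add_apply]; ring
    rw [hdiff]
    rcases e_apply_mem01 μ i with h | h <;> norm_num [h]

end Layer

/-! ## §2 The per-site clause of `H` from the pieces of (159) -/

section Site

variable {F : T3Family} {n K : ℕ}

/-- From the centre block to the evaluation bond at the top level: `dist_k(c₋, Bᵏx) ≤ distBI(b, c) + r₀` (the statement of
`HalvingDatum160.dist_le_distBI_add`, re-proved here to keep this module's imports light). [cite: Balaban1985Variational, (161) p.303] -/
private theorem dist_le_distBI_add' (x₀ : Site (F.P K) 0) (ρ S M : ℕ) (hM : 1 ≤ M) (c : BondIdx (cubeSeqMT3 F n K x₀ ρ S M hM))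
    (hc : (c.1.1 : ℕ) = K - n) {b : PBond (F.P K) 0} {r₀ : ℝ}
    (hb : distSite (Mk (F.P K) (K - n)) (iterBlockOf (K - n) b.src) (iterBlockOf (K - n) x₀) ≤ r₀) :
    distSite (Mk (F.P K) (c.1.1 : ℕ)) c.1.2.src (iterBlockOf (c.1.1 : ℕ) x₀) ≤ distBI (cubeSeqMT3 F n K x₀ ρ S M hM) b c + r₀ := by
  obtain ⟨⟨j, e⟩, hlam⟩ := c
  change (j : ℕ) = K - n at hc
  unfold distBI
  simp only
  have hk0 : (cubeSeqMT3 F n K x₀ ρ S M hM).k - (j : ℕ) = 0 := by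
    show (K - n) - (j : ℕ) = 0
    omega
  rw [hk0, pow_zero, one_mul]
  have key : ∀ (i : ℕ) (hi : i = K - n) (e' : PBond (F.P K) i),
      distSite (Mk (F.P K) i) e'.src (iterBlockOf i x₀) ≤ distSite (Mk (F.P K) i) (iterBlockOf i b.src) e'.src + r₀ := by
    intro i hi e'
    subst hi
    have htri := distSite_triangle (Mk (F.P K) (K - n)) e'.src (iterBlockOf (K - n) b.src) (iterBlockOf (K - n) x₀)
    rw [distSite_comm (Mk (F.P K) (K - n)) e'.src (iterBlockOf (K - n) b.src)] at htri
    linarith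
  exact key (j : ℕ) hc e

/-- **THE PER-SITE CLAUSE OF THE (167)-CHART SCHEMA FROM THE PIECES OF (159)** — see the module docstring.  The conclusion is LITERALLY the
`∃ Ω u A, x ∈ Ω k ∧ … ∧ [chart ∀ j ≤ k] ∧ [Cond140 ∀ j ≤ k]` clause of `Prop8LastMile.halvingMinimisers_of_localCharts167`'s hypothesis `H` at the site `x`
and the threshold `α₂`. [cite: Balaban1985Variational, (159) p.303, (164)-(168) p.304; Balaban1985RegularSpaces, (1.140) p.100] -/
theorem siteClause_of_pieces (hnK : n < K) (x : Site (F.P K) 0) (ρ S M : ℕ) (hM : 1 ≤ M)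
    {dBI : PBond (F.P K) 0 → BondIdx (cubeSeqMT3 F n K x ρ S M hM) → ℝ} {w : ℕ → PBond (F.P K) 0 → ℝ}
    {δ₀ B₀ B₃ C C₁ C₂ ε₁ ε₀ R₁M₁ e₁ e₃ α₂ : ℝ}
    (hw : IsLevWeight F n K (cubeSeqMT3 F n K x ρ S M hM) w)
    (hdom : ∀ b c, distBI (cubeSeqMT3 F n K x ρ S M hM) b c ≤ dBI b c)
    (hH : HDecayLetterD F n K (cubeSeqMT3 F n K x ρ S M hM) dBI w (flatH F n K (cubeSeqMT3 F n K x ρ S M hM)) B₀ δ₀)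
    (h162 : RowSum162 F n K (cubeSeqMT3 F n K x ρ S M hM) dBI w δ₀ B₃)
    (hδ₀ : 0 ≤ δ₀) (hB₀ : 0 ≤ B₀) (hB₃ : 0 ≤ B₃) (hC₁ : 0 ≤ C₁) (hC₁C : 2 * C₁ ≤ C) (hC₂C : C₂ ≤ C) (hε₁ : 0 ≤ ε₁) (hε₀ : 0 ≤ ε₀)
    (hR : 0 ≤ R₁M₁) (h163 : 4 * C * B₀ * B₃ * Real.exp (-(δ₀ / 2 * R₁M₁)) ≤ 1 / 2) (hρ : R₁M₁ ≤ (ρ : ℝ) - 2)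
    (hα₂ : e₁ + 1 / 4 * max (4 * C * B₀ * B₃ * ε₁) (ε₀ / 2) + e₃ < α₂)
    (U : GaugeField (F.P K) 0 (Matrix.specialUnitaryGroup (Fin 2) ℂ)) (u : GaugeTransf (F.P K) 0 (Matrix.unitaryGroup (Fin 2) ℂ))
    {A A₁ 𝔄 R : PBond (F.P K) 0 → Matrix (Fin 2) (Fin 2) ℂ} {B : BondIdx (cubeSeqMT3 F n K x ρ S M hM) → Matrix (Fin 2) (Fin 2) ℂ}
    (hA : ∀ b : PBond (F.P K) 0, IsSelfAdjoint (A b))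
    (hchart : ∀ (z : B7Prop1Explicit.Site (F.P K).d) (μ : Fin (F.P K).d),
      SideTouches (pullDom (fun j => if K - n ≤ j then ({x} : Set (Site (F.P K) 0)) else (∅ : Set (Site (F.P K) 0))) (K - n)) z μ →
      (Unitary.toUnits (u (transl 0 z)))⁻¹ * unitsField (toUField U) ⟨transl 0 z, μ⟩ * Unitary.toUnits (u ((transl 0 z).shift μ)) =
        expUnit (I • ((((F.L : ℝ)⁻¹) ^ (K - n)) • A ⟨transl 0 z, μ⟩)))
    (h𝔄 : ∀ b, 𝔄 b = ∑ c, flatH F n K (cubeSeqMT3 F n K x ρ S M hM) (Pi.single c 1) b • B c) (hdec : A = A₁ + 𝔄 - R)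
    (hnear : ∀ c : BondIdx (cubeSeqMT3 F n K x ρ S M hM), (c.1.1 : ℕ) = K - n →
      ‖B c‖ ≤ C₁ * ε₁ * (distSite (Mk (F.P K) (c.1.1 : ℕ)) c.1.2.src (iterBlockOf (c.1.1 : ℕ) x) + 1))
    (hfar : ∀ c : BondIdx (cubeSeqMT3 F n K x ρ S M hM), (c.1.1 : ℕ) < K - n →
      ‖B c‖ ≤ C₂ * ε₀ * (F.L : ℝ) ^ ((K - n) - (c.1.1 : ℕ)))
    (s₁ : ∀ (z : B7Prop1Explicit.Site (F.P K).d) (τ : Fin (F.P K).d),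
      SideTouches (pullDom (fun j => if K - n ≤ j then ({x} : Set (Site (F.P K) 0)) else (∅ : Set (Site (F.P K) 0))) (K - n)) z τ →
      ‖A₁ ⟨transl 0 z, τ⟩‖ ≤ e₁)
    (g₁ : ∀ (z : B7Prop1Explicit.Site (F.P K).d) (κ τ : Fin (F.P K).d),
      SideTouches (pullDom (fun j => if K - n ≤ j then ({x} : Set (Site (F.P K) 0)) else (∅ : Set (Site (F.P K) 0))) (K - n)) z τ →
      ‖(((F.L : ℝ)⁻¹) ^ (K - n))⁻¹ • (A₁ ⟨(transl 0 z).shift κ, τ⟩ - A₁ ⟨transl 0 z, τ⟩)‖ ≤ e₁)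
    (d₁ : ∀ (z : B7Prop1Explicit.Site (F.P K).d) (μ : Fin (F.P K).d),
      BondTouches (pullDom (fun j => if K - n ≤ j then ({x} : Set (Site (F.P K) 0)) else (∅ : Set (Site (F.P K) 0))) (K - n)) z μ →
      ‖pdiv (((F.L : ℝ)⁻¹) ^ (K - n)) (1 : B7Prop1Explicit.Site (F.P K).d → Fin (F.P K).d → (Matrix (Fin 2) (Fin 2) ℂ)ˣ)
          (plaqCovDeriv (((F.L : ℝ)⁻¹) ^ (K - n)) (1 : B7Prop1Explicit.Site (F.P K).d → Fin (F.P K).d → (Matrix (Fin 2) (Fin 2) ℂ)ˣ)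
            (pull A₁ 0)) μ z‖ ≤ e₁)
    (s₃ : ∀ (z : B7Prop1Explicit.Site (F.P K).d) (τ : Fin (F.P K).d),
      SideTouches (pullDom (fun j => if K - n ≤ j then ({x} : Set (Site (F.P K) 0)) else (∅ : Set (Site (F.P K) 0))) (K - n)) z τ →
      ‖R ⟨transl 0 z, τ⟩‖ ≤ e₃)
    (g₃ : ∀ (z : B7Prop1Explicit.Site (F.P K).d) (κ τ : Fin (F.P K).d),
      SideTouches (pullDom (fun j => if K - n ≤ j then ({x} : Set (Site (F.P K) 0)) else (∅ : Set (Site (F.P K) 0))) (K - n)) z τ →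
      ‖(((F.L : ℝ)⁻¹) ^ (K - n))⁻¹ • (R ⟨(transl 0 z).shift κ, τ⟩ - R ⟨transl 0 z, τ⟩)‖ ≤ e₃)
    (d₃ : ∀ (z : B7Prop1Explicit.Site (F.P K).d) (μ : Fin (F.P K).d),
      BondTouches (pullDom (fun j => if K - n ≤ j then ({x} : Set (Site (F.P K) 0)) else (∅ : Set (Site (F.P K) 0))) (K - n)) z μ →
      ‖pdiv (((F.L : ℝ)⁻¹) ^ (K - n)) (1 : B7Prop1Explicit.Site (F.P K).d → Fin (F.P K).d → (Matrix (Fin 2) (Fin 2) ℂ)ˣ)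
          (plaqCovDeriv (((F.L : ℝ)⁻¹) ^ (K - n)) (1 : B7Prop1Explicit.Site (F.P K).d → Fin (F.P K).d → (Matrix (Fin 2) (Fin 2) ℂ)ˣ)
            (pull R 0)) μ z‖ ≤ e₃) :
    ∃ (Ω : ℕ → Set (Site (F.P K) 0)) (u' : GaugeTransf (F.P K) 0 (Matrix.unitaryGroup (Fin 2) ℂ))
        (A' : GaugeField (F.P K) 0 (Matrix (Fin 2) (Fin 2) ℂ)),
        x ∈ Ω (K - n) ∧ (∀ b : PBond (F.P K) 0, IsSelfAdjoint (A' b)) ∧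
        (∀ j, j ≤ K - n → ∀ (z : B7Prop1Explicit.Site (F.P K).d) (μ : Fin (F.P K).d), SideTouches (pullDom Ω j) z μ →
          mgauge (cfgPull (F.P K) 1) (gaugePull (F.P K) u')⁻¹ (cfgPull (F.P K) (toUField U)) z μ =
            cfgExp (((F.L : ℝ)⁻¹) ^ (K - n)) (pull A' 0) z μ) ∧
        (∀ j, j ≤ K - n → Cond140 (F.P K).L (((F.L : ℝ)⁻¹) ^ (K - n)) α₂ j (pullDom Ω j) (cfgPull (F.P K) 1) (pull A' 0)) := by
  set q : ℝ := 1 / 4 * max (4 * C * B₀ * B₃ * ε₁) (ε₀ / 2) with hq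
  have hkm : K - n ≤ (F.P K).m + (F.P K).K := FlatMinimizerH.le_T3 F n K
  have hC : 0 ≤ C := by linarith
  have hLk : (0 : ℝ) < (F.L : ℝ) ^ (K - n) := by
    have : (0 : ℝ) < (F.L : ℝ) := by exact_mod_cast lt_trans zero_lt_one F.hL.2
    positivity
  have hη : ((((F.L : ℝ)⁻¹) ^ (K - n))⁻¹ : ℝ) = (F.L : ℝ) ^ (K - n) := by rw [inv_pow, inv_inv]
  -- the sizes of `B` in the currency of `matrixRows164_quarter_top` (`M_Δ = 1`, `r₀ = 1`), at a bond `b` one block from `Bᵏ(x)`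
  have hnear' : ∀ {b : PBond (F.P K) 0}, distSite (Mk (F.P K) (K - n)) (iterBlockOf (K - n) b.src) (iterBlockOf (K - n) x) ≤ 1 →
      ∀ c : BondIdx (cubeSeqMT3 F n K x ρ S M hM), (c.1.1 : ℕ) = K - n →
        ‖B c‖ ≤ C * 1 * ε₁ * (distBI (cubeSeqMT3 F n K x ρ S M hM) b c + 1) := by
    intro b hb c hc
    have hd := dist_le_distBI_add' x ρ S M hM c hc hb
    have hD := HalvingQuarterCubeSeq.distBI_nonneg (cubeSeqMT3 F n K x ρ S M hM) b c
    have h1 : C₁ * ε₁ * (distBI (cubeSeqMT3 F n K x ρ S M hM) b c + 1 + 1) ≤ 2 * C₁ * (ε₁ * (distBI (cubeSeqMT3 F n K x ρ S M hM) b c + 1)) := by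
      nlinarith [mul_nonneg (mul_nonneg hC₁ hε₁) hD]
    have h2 : 2 * C₁ * (ε₁ * (distBI (cubeSeqMT3 F n K x ρ S M hM) b c + 1)) ≤ C * (ε₁ * (distBI (cubeSeqMT3 F n K x ρ S M hM) b c + 1)) :=
      mul_le_mul_of_nonneg_right hC₁C (mul_nonneg hε₁ (by linarith))
    calc ‖B c‖ ≤ C₁ * ε₁ * (distSite (Mk (F.P K) (c.1.1 : ℕ)) c.1.2.src (iterBlockOf (c.1.1 : ℕ) x) + 1) := hnear c hc
      _ ≤ C₁ * ε₁ * (distBI (cubeSeqMT3 F n K x ρ S M hM) b c + 1 + 1) := mul_le_mul_of_nonneg_left (by linarith) (by positivity)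
      _ ≤ C * 1 * ε₁ * (distBI (cubeSeqMT3 F n K x ρ S M hM) b c + 1) := by rw [mul_one]; linarith
  have hfar' : ∀ c : BondIdx (cubeSeqMT3 F n K x ρ S M hM), (c.1.1 : ℕ) < K - n →
      ‖B c‖ ≤ C * 1 * ε₀ * (F.L : ℝ) ^ ((K - n) - (c.1.1 : ℕ)) := by
    intro c hc
    have hLp : (0 : ℝ) ≤ (F.L : ℝ) ^ ((K - n) - (c.1.1 : ℕ)) := by positivity
    calc ‖B c‖ ≤ C₂ * ε₀ * (F.L : ℝ) ^ ((K - n) - (c.1.1 : ℕ)) := hfar c hc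
      _ ≤ C * 1 * ε₀ * (F.L : ℝ) ^ ((K - n) - (c.1.1 : ℕ)) := by
          rw [mul_one]; exact mul_le_mul_of_nonneg_right (mul_le_mul_of_nonneg_right hC₂C hε₀) hLp
  have hρ' : R₁M₁ ≤ (ρ : ℝ) - 1 - 1 := by linarith
  -- the three letters of `𝔄 = HB` at every bond one block from `Bᵏ(x)`
  have rows : ∀ {b : PBond (F.P K) 0}, distSite (Mk (F.P K) (K - n)) (iterBlockOf (K - n) b.src) (iterBlockOf (K - n) x) ≤ 1 →
      ‖𝔄 b‖ ≤ q ∧ (∀ κ : Fin 3, (F.L : ℝ) ^ (K - n) * ‖𝔄 ⟨b.src.shift κ, b.dir⟩ - 𝔄 b‖ ≤ q) ∧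
      ∀ (z : B7Prop1Explicit.Site (F.P K).d) (μ : Fin (F.P K).d), b = ⟨transl 0 z, μ⟩ →
        ‖pdiv (((F.L : ℝ)⁻¹) ^ (K - n)) (1 : B7Prop1Explicit.Site (F.P K).d → Fin (F.P K).d → (Matrix (Fin 2) (Fin 2) ℂ)ˣ)
            (plaqCovDeriv (((F.L : ℝ)⁻¹) ^ (K - n)) (1 : B7Prop1Explicit.Site (F.P K).d → Fin (F.P K).d → (Matrix (Fin 2) (Fin 2) ℂ)ˣ)
              (pull 𝔄 0)) μ z‖ ≤ q := by
    intro b hb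
    have h := matrixRows164_quarter_top hnK x ρ S M hM hw hdom hH h162 hδ₀ hB₀ hB₃ hC zero_le_one hε₁ hε₀ hR h163 hρ' h𝔄 hb
      (hnear' hb) hfar'
    simp only [mul_one] at h
    simpa [hq] using h
  -- the layer geometry: sources one block from `Bᵏ(x)`
  have hbS : ∀ {z : B7Prop1Explicit.Site (F.P K).d} {τ : Fin (F.P K).d},
      SideTouches (pullDom (fun j => if K - n ≤ j then ({x} : Set (Site (F.P K) 0)) else (∅ : Set (Site (F.P K) 0))) (K - n)) z τ →
      distSite (Mk (F.P K) (K - n)) (iterBlockOf (K - n) (⟨transl 0 z, τ⟩ : PBond (F.P K) 0).src) (iterBlockOf (K - n) x) ≤ 1 :=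
    fun hz => distSite_iterBlockOf_le_one_of_le_one hkm (dist_le_one_of_sideTouches x (K - n) hz)
  have hbB : ∀ {z : B7Prop1Explicit.Site (F.P K).d} {μ : Fin (F.P K).d},
      BondTouches (pullDom (fun j => if K - n ≤ j then ({x} : Set (Site (F.P K) 0)) else (∅ : Set (Site (F.P K) 0))) (K - n)) z μ →
      distSite (Mk (F.P K) (K - n)) (iterBlockOf (K - n) (⟨transl 0 z, μ⟩ : PBond (F.P K) 0).src) (iterBlockOf (K - n) x) ≤ 1 :=
    fun hz => distSite_iterBlockOf_le_one_of_le_one hkm (dist_le_one_of_bondTouches x (K - n) hz)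
  -- the `𝔄`-letters on the layers
  have s₂ : ∀ (z : B7Prop1Explicit.Site (F.P K).d) (τ : Fin (F.P K).d),
      SideTouches (pullDom (fun j => if K - n ≤ j then ({x} : Set (Site (F.P K) 0)) else (∅ : Set (Site (F.P K) 0))) (K - n)) z τ →
      ‖𝔄 ⟨transl 0 z, τ⟩‖ ≤ q :=
    fun z τ hz => (rows (hbS hz)).1
  have g₂ : ∀ (z : B7Prop1Explicit.Site (F.P K).d) (κ τ : Fin (F.P K).d),
      SideTouches (pullDom (fun j => if K - n ≤ j then ({x} : Set (Site (F.P K) 0)) else (∅ : Set (Site (F.P K) 0))) (K - n)) z τ →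
      ‖(((F.L : ℝ)⁻¹) ^ (K - n))⁻¹ • (𝔄 ⟨(transl 0 z).shift κ, τ⟩ - 𝔄 ⟨transl 0 z, τ⟩)‖ ≤ q := by
    intro z κ τ hz
    rw [hη, norm_smul, Real.norm_of_nonneg hLk.le]
    exact (rows (hbS hz)).2.1 κ
  have d₂ : ∀ (z : B7Prop1Explicit.Site (F.P K).d) (μ : Fin (F.P K).d),
      BondTouches (pullDom (fun j => if K - n ≤ j then ({x} : Set (Site (F.P K) 0)) else (∅ : Set (Site (F.P K) 0))) (K - n)) z μ →
      ‖pdiv (((F.L : ℝ)⁻¹) ^ (K - n)) (1 : B7Prop1Explicit.Site (F.P K).d → Fin (F.P K).d → (Matrix (Fin 2) (Fin 2) ℂ)ˣ)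
          (plaqCovDeriv (((F.L : ℝ)⁻¹) ^ (K - n)) (1 : B7Prop1Explicit.Site (F.P K).d → Fin (F.P K).d → (Matrix (Fin 2) (Fin 2) ℂ)ˣ)
            (pull 𝔄 0)) μ z‖ ≤ q :=
    fun z μ hz => (rows (hbB hz)).2.2 z μ rfl
  -- (159) ⇒ the three torus letters of `A` at threshold `α₂`
  obtain ⟨h1, h2, h3⟩ := torusBounds_of_decomp hdec (by linarith : e₁ + q + e₃ < α₂) _ s₁ s₂ s₃ g₁ g₂ g₃ d₁ d₂ d₃
  -- the socket's per-site clause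
  exact localChart_top_of_torus F n K x U {x} u A (Set.mem_singleton x) hA hchart h1 h2 h3

end Site

end Summit.QuantumFields.YangMills.Theorems.HalvingSiteAssembly

end
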